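import Summits.CriticalPhenomena.Ising3DConformalLimit.Theorems.FKParityRobustnessFKFourConnectivityDefs
import Literature.Probability.LatticeModels.RandomClusterFKG
import Literature.Probability.Percolation.PercolationEvents

/-!
# Crux `FKFourConnectivity` (stmt-CriticalPhenomena-11254), line `cluster-hole-opacity`:
# the small-scale half of THICK (stub `stub_thickSmall`)

For `1 ≤ l < 16` the dyadic level `lvl l = ⌊log₂ l⌋ − 3` is `0` (`lvl_eq_zero_of_lt`), so
`IsThick l K` only asks for a point of `K` in `Λ_{2l} = box 3 (2 * l)` (`thickAt_zero`).  The open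
cluster of `a₀` contains `a₀ = l • tetra 0 = (−l,−l,−l) ∈ Λ_{2l}` itself (`mem_openCluster_self`),
hence the thick event `thickEvent l N (a 0)` is the sure event (`thickEvent_eq_univ_of_lt`),
`{a₀ ↔ a₁} ∩ thickEvent = {a₀ ↔ a₁}`, and the inequality is an equality.
-/

noncomputable section

open MeasureTheory Finset
open Literature.Probability.LatticeModels Literature.Probability.Percolation

namespace Summit.CriticalPhenomena.Ising3DConformalLimit.Cruxes.FKFourConnectivity.ClusterHoleOpacity

open scoped Classical

/-- Every coordinate of the first vertex `tetra 0 = (−1,−1,−1)` of the unit tetrahedron is `−1`. -/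
theorem tetra_zero_apply (i : Fin 3) : tetra 0 i = -1 := by
  unfold tetra
  fin_cases i <;> rfl

/-- The source `a₀ = l • tetra 0 = (−l,−l,−l)` lies in the box `Λ_{2l}`. -/
theorem smul_tetra_zero_mem_box (l : ℕ) : (l : ℤ) • tetra 0 ∈ box 3 (2 * l) := by
  rw [mem_box]
  intro i
  rw [Pi.smul_apply, smul_eq_mul, tetra_zero_apply, mul_neg_one]
  push_cast
  constructor <;> omega

/-- For `l < 16` the thick event at scale `l` of the cluster of a vertex sitting at `l • tetra 0` is
the sure event: level `lvl l = 0` thickness is membership, and the vertex lies in its own cluster and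
in `Λ_{2l}`. -/
theorem thickEvent_eq_univ_of_lt {l : ℕ} (hl : l < 16) {N : ℕ} (x : ↥(box 3 N))
    (hx : ((x : Site 3)) = (l : ℤ) • tetra 0) : thickEvent l N x = Set.univ := by
  refine Set.eq_univ_of_forall fun ω => ?_
  show IsThick l (Subtype.val '' openCluster ω x)
  refine ⟨(x : Site 3), ?_, ?_⟩
  · rw [hx]
    exact smul_tetra_zero_mem_box l
  · rw [lvl_eq_zero_of_lt hl, thickAt_zero]
    exact Set.mem_image_of_mem _ (mem_openCluster_self ω x)

/-- STUB THICK-SMALL (registered stub `stub_thickSmall` of the skeleton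
`Cruxes/FKFourConnectivity/Lines/cluster-hole-opacity.lean`, crux `FKFourConnectivity`,
stmt-CriticalPhenomena-11254) — the small-scale half of `ThickCluster`: for `1 ≤ l < 16` the dyadic
level `lvl l = ⌊log₂ l⌋ − 3` is `0`, so "2-thick at scale `l`" only asks that the cluster of `a₀` meet
`Λ_{2l}`, which it does at `a₀ = (−l,−l,−l)` itself: the thick event is SURE, for every `N` and every
placement `a = l·tetra`, so both sides are the same number `φ_N(a₀ ↔ a₁)`. -/
theorem stub_thickSmall :
    ∀ l : ℕ, 1 ≤ l → l < 16 → ∀ (N : ℕ) (a : Fin 4 → ↥(box 3 N)),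
      (∀ i, ((a i : Site 3)) = (l : ℤ) • tetra i) →
        (fkBox N).real (openConn (a 0) (a 1)) ≤
          (fkBox N).real (openConn (a 0) (a 1) ∩ thickEvent l N (a 0)) := by
  intro l _hl1 hl16 N a ha
  rw [thickEvent_eq_univ_of_lt hl16 (a 0) (ha 0), Set.inter_univ]

end Summit.CriticalPhenomena.Ising3DConformalLimit.Cruxes.FKFourConnectivity.ClusterHoleOpacity

end
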